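import Literature.Geometry.Symplectic.SphereCRFamily
import Literature.Geometry.Symplectic.SphereCRLevels
import HarnessLib

/-!
# The section-valued chart Cauchy–Riemann operators and the implicit-function map across levels

Layer B7 (infrastructure) of the analytic core of the Hofer–Lizan–Sikorav local foliation theorem
(Wendl 2018, Thm. 2.46; lead of crux `WitnessCharge`, summit `SmoothPoincare4`), continuing
`SphereCRLevels.lean` (level inclusions `SecPair.inclLE hr h : SecPair k' r →L SecPair k r`,
`h : k ≤ k'`, and the compatibility of `out₀`, `PT`, `dPT`, … with them) to the operators of
`SphereCROperatorLinearisation.lean` and `SphereCRFamily.lean`: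

* `FT_inclLE : FT hr k (inclLE y) = inclLE (FT hr k' y)`, `FN_inclLE` (both branches of the
  defining `dite`: membership of the pieces is level independent), hence
  `FT_inclLE_eq_zero_iff`, `FN_inclLE_eq_zero_iff`;
* `LT_inclLE`, `LN_inclLE`, `linEquiv_inclLE` — the (bordered) linearisation at `0`;
* `Gmap_inclLE`, `Gmap_inclLE_components`, `Gmap_inclLE_eq_zero_iff` — the implicit-function map
  `G (a, y) = ((FT y, FN y), (slice₃ y.1, y.2 (0) - a))`: its section components are included, its
  finite-dimensional components are unchanged, so `G` vanishes at `(a, inclLE y)` iff at `(a, y)`.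

This is what lets the implicit-function family of one level be compared with that of a higher
level (uniqueness in the lower level, existence in the higher). Everything is proved; no named
facts.

## References

* C. Wendl, *Holomorphic Curves in Low Dimensions*, LNM 2216 (2018), §2.3, Thm. 2.46. [Wendl2018]
-/

noncomputable section

open Set Filter Metric Function Complex
open scoped Topology NNReal ContDiff
open Literature.Analysis.FunctionSpaces Literature.Analysis.Complex.RiemannSphere
open Literature.Analysis.Complex Literature.Geometry.Symplectic.CRExpression

namespace Literature.Geometry.Symplectic

namespace SphereCR

namespace SphereACData

variable (𝒥 : SphereACData) {r : ℝ≥0} (hr : r ≤ 1) {k k' : ℕ} (h : k ≤ k')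

/-- **The tangent operator with values in `𝓗T'` commutes with the level inclusions**:
`FT hr k (inclLE y) = inclLE (FT hr k' y)` (in both branches of the `dite`: the membership
conditions agree, `PT_inclLE_mem_iff`). [cite: Wendl2018, Thm. 2.46] -/
theorem FT_inclLE (y : SecPair k' r) :
    𝒥.FT hr k (SecPair.inclLE hr h y) = RiemannSphere.inclLE hr h (𝒥.FT hr k' y) := by
  unfold FT
  by_cases hm : 𝒥.PT hr k' y ∈ holderSections ℂ (dbarClutch (fun w : ℂ => -w ^ 2)) k' r
  · have hm' := (𝒥.PT_inclLE_mem_iff hr h y).2 hm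
    rw [dif_pos hm', dif_pos hm]
    exact Subtype.ext (𝒥.PT_inclLE hr h y)
  · have hm' : 𝒥.PT hr k (SecPair.inclLE hr h y) ∉
        holderSections ℂ (dbarClutch (fun w : ℂ => -w ^ 2)) k r :=
      fun h' => hm ((𝒥.PT_inclLE_mem_iff hr h y).1 h')
    rw [dif_neg hm', dif_neg hm, map_zero]

/-- **The normal operator with values in `𝓗N'` commutes with the level inclusions.**
[cite: Wendl2018, Thm. 2.46] -/
theorem FN_inclLE (y : SecPair k' r) :
    𝒥.FN hr k (SecPair.inclLE hr h y) = RiemannSphere.inclLE hr h (𝒥.FN hr k' y) := by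
  unfold FN
  by_cases hm : 𝒥.PN hr k' y ∈ holderSections ℂ (dbarClutch (1 : ℂ → ℂ)) k' r
  · have hm' := (𝒥.PN_inclLE_mem_iff hr h y).2 hm
    rw [dif_pos hm', dif_pos hm]
    exact Subtype.ext (𝒥.PN_inclLE hr h y)
  · have hm' : 𝒥.PN hr k (SecPair.inclLE hr h y) ∉ holderSections ℂ (dbarClutch (1 : ℂ → ℂ)) k r :=
      fun h' => hm ((𝒥.PN_inclLE_mem_iff hr h y).1 h')
    rw [dif_neg hm', dif_neg hm, map_zero]

/-- `FT` vanishes at `inclLE y` iff it vanishes at `y`. [folklore] -/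
theorem FT_inclLE_eq_zero_iff (y : SecPair k' r) :
    𝒥.FT hr k (SecPair.inclLE hr h y) = 0 ↔ 𝒥.FT hr k' y = 0 := by
  rw [𝒥.FT_inclLE hr h,
    ← map_zero (RiemannSphere.inclLE (F := ℂ) (τ := dbarClutch (fun w : ℂ => -w ^ 2)) hr h),
    (RiemannSphere.inclLE_injective hr h).eq_iff]

/-- `FN` vanishes at `inclLE y` iff it vanishes at `y`. [folklore] -/
theorem FN_inclLE_eq_zero_iff (y : SecPair k' r) :
    𝒥.FN hr k (SecPair.inclLE hr h y) = 0 ↔ 𝒥.FN hr k' y = 0 := by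
  rw [𝒥.FN_inclLE hr h,
    ← map_zero (RiemannSphere.inclLE (F := ℂ) (τ := dbarClutch (1 : ℂ → ℂ)) hr h),
    (RiemannSphere.inclLE_injective hr h).eq_iff]

/-- **The tangent linearisation at `0` commutes with the level inclusions**:
`LT hr k (inclLE δ) = inclLE (LT hr k' δ)`. [cite: Wendl2018, Thm. 2.46] -/
theorem LT_inclLE (δ : SecPair k' r) :
    𝒥.LT hr k (SecPair.inclLE hr h δ) = RiemannSphere.inclLE hr h (𝒥.LT hr k' δ) := by
  refine Subtype.ext ?_
  rw [coe_LT, RiemannSphere.coe_inclLE, coe_LT, ← map_zero (SecPair.inclLE hr h),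
    𝒥.dPT_inclLE hr h]

/-- **The normal linearisation at `0` commutes with the level inclusions.**
[cite: Wendl2018, Thm. 2.46] -/
theorem LN_inclLE (δ : SecPair k' r) :
    𝒥.LN hr k (SecPair.inclLE hr h δ) = RiemannSphere.inclLE hr h (𝒥.LN hr k' δ) := by
  refine Subtype.ext ?_
  rw [coe_LN, RiemannSphere.coe_inclLE, coe_LN, ← map_zero (SecPair.inclLE hr h),
    𝒥.dPN_inclLE hr h]

/-- **The bordered linearisation at `0` commutes with the level inclusions** (`1 ≤ k ≤ k'`).
[cite: Wendl2018, Thm. 2.46] -/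
theorem linEquiv_inclLE (hr0 : 0 < r) (hr1 : r < 1) (hk : 1 ≤ k) (h : k ≤ k') (δ : SecPair k' r) :
    𝒥.linEquiv hr0 hr1 hk (SecPair.inclLE hr1.le h δ) =
      (Prod.map (RiemannSphere.inclLE hr1.le h) (RiemannSphere.inclLE hr1.le h)
          (𝒥.linEquiv hr0 hr1 (hk.trans h) δ).1,
        (𝒥.linEquiv hr0 hr1 (hk.trans h) δ).2) := by
  rw [𝒥.linEquiv_apply hr0 hr1 hk, 𝒥.linEquiv_apply hr0 hr1 (hk.trans h), Prod.map_apply,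
    𝒥.LT_inclLE hr1.le h, 𝒥.LN_inclLE hr1.le h, SecPair.inclLE_fst, SecPair.inclLE_snd,
    RiemannSphere.slice₃_inclLE, RiemannSphere.eval₀CLM_inclLE]

/-- **The implicit-function map commutes with the level inclusions**: the section components of
`Gmap hr k (a, inclLE y)` are the inclusions of those of `Gmap hr k' (a, y)`, and the
finite-dimensional components (three-point slice, border value) agree.
[cite: Wendl2018, Thm. 2.46] -/
theorem Gmap_inclLE (a : ℂ) (y : SecPair k' r) :
    𝒥.Gmap hr k (a, SecPair.inclLE hr h y) =
      (Prod.map (RiemannSphere.inclLE hr h) (RiemannSphere.inclLE hr h) (𝒥.Gmap hr k' (a, y)).1,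
        (𝒥.Gmap hr k' (a, y)).2) := by
  simp only [Gmap, Prod.map_apply, 𝒥.FT_inclLE hr h, 𝒥.FN_inclLE hr h, SecPair.inclLE_fst,
    SecPair.inclLE_snd, RiemannSphere.slice₃_inclLE, RiemannSphere.eval₀CLM_inclLE]

/-- Componentwise form of `Gmap_inclLE`. [folklore] -/
theorem Gmap_inclLE_components (a : ℂ) (y : SecPair k' r) :
    (𝒥.Gmap hr k (a, SecPair.inclLE hr h y)).1.1 =
        RiemannSphere.inclLE hr h (𝒥.Gmap hr k' (a, y)).1.1 ∧
      (𝒥.Gmap hr k (a, SecPair.inclLE hr h y)).1.2 =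
        RiemannSphere.inclLE hr h (𝒥.Gmap hr k' (a, y)).1.2 ∧
      (𝒥.Gmap hr k (a, SecPair.inclLE hr h y)).2 = (𝒥.Gmap hr k' (a, y)).2 := by
  rw [𝒥.Gmap_inclLE hr h]
  exact ⟨rfl, rfl, rfl⟩

/-- **`Gmap` vanishes at `(a, inclLE y)` iff it vanishes at `(a, y)`** (the inclusions are
injective). [folklore] -/
theorem Gmap_inclLE_eq_zero_iff (a : ℂ) (y : SecPair k' r) :
    𝒥.Gmap hr k (a, SecPair.inclLE hr h y) = 0 ↔ 𝒥.Gmap hr k' (a, y) = 0 := by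
  rw [𝒥.Gmap_inclLE hr h]
  constructor
  · intro h0
    rw [Prod.ext_iff, Prod.fst_zero, Prod.snd_zero, Prod.ext_iff, Prod.map_fst, Prod.map_snd,
      Prod.fst_zero, Prod.snd_zero] at h0
    obtain ⟨⟨h1, h2⟩, h3⟩ := h0
    rw [← map_zero (RiemannSphere.inclLE (F := ℂ) (τ := dbarClutch (fun w : ℂ => -w ^ 2)) hr h)]
      at h1
    rw [← map_zero (RiemannSphere.inclLE (F := ℂ) (τ := dbarClutch (1 : ℂ → ℂ)) hr h)] at h2
    exact Prod.ext (Prod.ext (RiemannSphere.inclLE_injective hr h h1)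
      (RiemannSphere.inclLE_injective hr h h2)) h3
  · intro h0
    simp only [h0, Prod.fst_zero, Prod.snd_zero, Prod.map_apply', map_zero, Prod.mk_zero_zero]

end SphereACData

end SphereCR

end Literature.Geometry.Symplectic

end
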